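import Literature.MathematicalPhysics.QuantumFieldTheory.Balaban1983to89.HiggsFluctMeasure
import Literature.MathematicalPhysics.QuantumFieldTheory.Balaban1983to89.HiggsCovarianceCont
import Literature.MathematicalPhysics.QuantumFieldTheory.Balaban1983to89.B1Eq214Concrete

/-!
# `Balaban1983to89.HiggsFluctMeasurePos` — T. Bałaban, *(Higgs)₂,₃ quantum fields in a finite volume. I. A lower bound*,
Commun. Math. Phys. **85** (1982) 603–626 [Balaban1982Higgs1] p. 611: *"It is not clear from the formulas (2.30), (2.31)
that the covariances are well defined. It is so"* — PROVED for the concrete fluctuation covariances `C^{(j),L^jη}` of the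
vector field (`…HiggsFluctMeasure.precOp`, the operator inverted in (2.30) at *"N = d, external field A = 0"*): the
operator is POSITIVE DEFINITE, hence invertible, the Gaussian weight `exp(−½⟨A′,(C^{(j)})^{−1}A′⟩)` is integrable and
the measures `dμ_{C^{(j),L^jη}}` of III (1.4) / I (3.35) (`…HiggsFluctMeasure.fluctMeasure`, `fluctFamily`) are
probability measures — unconditionally in the paper's regime `m² > 0` (here: vector mass `msq > 0`), `a > 0`, `L > 1`,
levels `j ≤ K`; theorems only

statement-level skeleton of published theorems with citation tags; proofs where landed; nothing here is a claim about the Yang–Mills mass gap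

PDF held: `paper:balaban1982-cmp85-higgs23-i` (journal page = PDF page + 602); pp. 609–611, 617 read on the ×2 renders
`run/shared/lean/pub/pub-balaban/b2b-balaban-ref1/pages/1982-cmp85-higgs23-I/…-p007, -p008, -p009, -p015-x2.png`.

CITATION HEADER (lean-in-tree rule).  lit-balaban typed skeleton (HOME `run/shared/lean/pub/lit-balaban/`), typer
line, companion of the carrier `HiggsFluctMeasure` (row **B3.Eq1.4**, owner r15; rows B1.Eq2.30 / B1.Prop2.3 of r01/r14
are NOT re-led by this file — the schematic well-definedness for `U = 1` is the tree's `B1RG242Torus.C_arg`; here the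
same printed remark is proved for the concrete (Higgs)₂,₃ vector-field covariances).  THE SOURCE TEXT, p. 611 [PDF 9],
verbatim: *"C^{(k),L^kε}(Ω, A) = (a(L^{k+1}ε)^{−2}P(A) + Δ^{(k),L^kε}(Ω, A))^{−1}. (2.30) … It is not clear from the formulas
(2.30), (2.31) that the covariances are well defined. It is so, and it is one of the assertions of Proposition 2.3."*;
p. 610 (2.21): *"⟨ψ, Δ^{(k),L^kε}(Ω, A)ψ⟩ = a_k(L^kε)^{−2}⟨ψ,ψ⟩ − a_k²(L^kε)^{−4}⟨ψ, Q_k(A)G^ε_k(Ω, A)Q_k^*(A)ψ⟩"*;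
p. 617: *"The fields A′_j … are independent Gaussian random variables with the covariances C^{(j),L^jε}"*.

THE ARGUMENT (ours; the paper defers to Prop. 2.3, whose uniform bounds (2.33) are not needed for mere
well-definedness).  (§1) `Q_j^*` is injective for `j ≤ K` (every site of `T^{(j)}` is the `j`-th block point of some
site of `T_η`: `B1Eq214Concrete.blockOf_blockSite`).  (§2) `⟨f, P(0)f⟩ = (L^jη)^d L^{−d} Σ_y |Σ_{x∈B(y)} f(x)|² ≥ 0`.
(§3) `⟨f, Δ^{(0)}f⟩ ≥ msq⟨f,f⟩` (`−Δ^η ≥ 0`, `HiggsCovariancePos.siteInner_covLaplacianN_nonneg`).  (§4) For `j ≥ 1`,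
`ψ ≠ 0`: with `c = a_j(L^jη)^{−2} > 0`, `f = Q_j^*ψ ≠ 0`, `φ = G^η_jf` (so `(−Δ^η + msq + cP_j)φ = f`,
`HiggsCovariancePos.covOpK_propagatorK_apply`): `X := ⟨f, G_jf⟩ = ⟨φ,(−Δ+msq)φ⟩ + c|Q_jφ|² > c|Q_jφ|²` (`φ ≠ 0`,
`msq > 0`) and `X = ⟨Q_j^*ψ, φ⟩ = ⟨ψ, Q_jφ⟩ ≤ |ψ||Q_jφ|` (adjointness `HiggsCovariancePos.siteInner_avgQkLin`,
Cauchy–Schwarz `HiggsCovarianceCont.abs_siteInner_le`), whence `c|Q_jφ| < |ψ|` and `cX < |ψ|²`, i.e.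
`⟨ψ, Δ^{(j)}ψ⟩ = c(|ψ|² − cX) > 0` by (2.21).  (§5) So the operator of (2.30) is positive definite, injective, a unit
(`isUnit_precOp`: `C^{(j),L^jη}` is its honest two-sided inverse).  (§6) A positive definite quadratic form on the
finite-dimensional space of bond functions dominates `c₀Σ_b A_b²` for some `c₀ > 0` (minimum on the unit sphere of the
sup norm, 2-homogeneity), so `exp(−½⟨A′,(C^{(j)})^{−1}A′⟩) ≤ Π_b exp(−(c₀/2)A′_b²)`, a product of one-dimensional Gaussians:
integrable (`integrable_gaussWeight`); (§7) hence `dμ_{C^{(j),L^jη}}` and `Π_{j<k}dμ_{C^{(j)}}` (`k ≤ K`) are probability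
measures (`isProbabilityMeasure_fluctMeasure`, `isProbabilityMeasure_fluctFamily` of the carrier, hypotheses discharged).
Unit `lit-balaban-typer` gen 4 (literature-prover-lit-balaban-typer-g4-0); HOME/FILED.md records the proposal.
-/

open scoped BigOperators ENNReal RealInnerProductSpace
open _root_.MeasureTheory

namespace Literature.MathematicalPhysics.QuantumFieldTheory.Balaban1983to89.HiggsFluctMeasurePos

open Literature.MathematicalPhysics.QuantumFieldTheory.Balaban1983to89.HiggsLattice
open Literature.MathematicalPhysics.QuantumFieldTheory.Balaban1983to89.HiggsAveraging
open Literature.MathematicalPhysics.QuantumFieldTheory.Balaban1983to89.HiggsCovariance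
open Literature.MathematicalPhysics.QuantumFieldTheory.Balaban1983to89.B3MultiscaleFields
open Literature.MathematicalPhysics.QuantumFieldTheory.Balaban1983to89.HiggsFluctMeasure
open Literature.MathematicalPhysics.QuantumFieldTheory.Balaban1983to89.HiggsCovariancePos
open Literature.MathematicalPhysics.QuantumFieldTheory.Balaban1983to89.HiggsCovarianceCont

variable {P : Params}

/-! ## 0. Algebra of the scalar product (I.1.5) -/

section Algebra

variable {j M : ℕ}

/-- (1.5) is symmetric. [cite: Balaban1982Higgs1, (1.5) p.604] -/
theorem siteInner_comm (f g : ScalarField P j M) : siteInner f g = siteInner g f := by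
  unfold siteInner
  exact Finset.sum_congr rfl fun x _ => by rw [real_inner_comm]

/-- (1.5) is additive in the second argument. [cite: Balaban1982Higgs1, (1.5) p.604] -/
theorem siteInner_add_right (f g h : ScalarField P j M) : siteInner f (g + h) = siteInner f g + siteInner f h := by
  simp only [siteInner, Pi.add_apply, inner_add_right, mul_add, Finset.sum_add_distrib]

/-- (1.5) is subtractive in the second argument. [cite: Balaban1982Higgs1, (1.5) p.604] -/
theorem siteInner_sub_right (f g h : ScalarField P j M) : siteInner f (g - h) = siteInner f g - siteInner f h := by
  simp only [siteInner, Pi.sub_apply, inner_sub_right, mul_sub, Finset.sum_sub_distrib]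

/-- (1.5) is homogeneous in the second argument. [cite: Balaban1982Higgs1, (1.5) p.604] -/
theorem siteInner_smul_right (c : ℝ) (f g : ScalarField P j M) : siteInner f (c • g) = c * siteInner f g := by
  simp only [siteInner, Pi.smul_apply, inner_smul_right, Finset.mul_sum]
  exact Finset.sum_congr rfl fun x _ => by ring

/-- (1.5) is homogeneous in the first argument. [cite: Balaban1982Higgs1, (1.5) p.604] -/
theorem siteInner_smul_left (c : ℝ) (f g : ScalarField P j M) : siteInner (c • f) g = c * siteInner f g := by
  rw [siteInner_comm, siteInner_smul_right, siteInner_comm]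

/-- `|f| = 0 ↔ f = 0` for the norm of (1.5). [cite: Balaban1982Higgs1, (1.5) p.604] -/
theorem sNorm_eq_zero_iff (f : ScalarField P j M) : sNorm f = 0 ↔ f = 0 := by
  constructor
  · intro h
    have h2 : siteInner f f = 0 := by
      have := sNorm_sq f
      rw [h] at this
      simpa using this.symm
    exact eq_zero_of_siteInner_self_eq_zero f h2
  · rintro rfl
    exact sNorm_zero

/-- `⟨f, g⟩ ≤ |f||g|` (Cauchy–Schwarz, `HiggsCovarianceCont.abs_siteInner_le`). [cite: Balaban1982Higgs1, (1.5) p.604] -/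
theorem siteInner_le_sNorm_mul (f g : ScalarField P j M) : siteInner f g ≤ sNorm f * sNorm g :=
  (le_abs_self _).trans (abs_siteInner_le f g)

end Algebra

/-! ## 1. `Q_j^*` is injective for `j ≤ K` -/

section Blocks

/-- The block map `T^{(k)} → T^{(k+1)}` is onto for `k < K` (every coarse site has the fine site of its block at
position `0`, `B1Eq214Concrete.blockSite`). [cite: Balaban1982Higgs1, (1.17) p.606] -/
theorem blockOf_surjective {k : ℕ} (hk : k < P.K) : Function.Surjective (blockOf : Site P k → Site P (k + 1)) :=
  fun y => ⟨B1Eq214Concrete.blockSite y fun _ => ⟨0, P.hL⟩, B1Eq214Concrete.blockOf_blockSite hk y _⟩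

/-- The `j`-th block point map `x ↦ x_j`, `T_η → T^{(j)}`, is onto for `j ≤ K`. [cite: Balaban1982Higgs1, (2.2) p.608] -/
theorem blockIter_surjective : ∀ {j : ℕ}, j ≤ P.K → Function.Surjective (blockIter (P := P) j)
  | 0, _ => fun y => ⟨y, rfl⟩
  | j + 1, h => fun z => by
      obtain ⟨y, hy⟩ := blockOf_surjective (P := P) (k := j) (by omega) z
      obtain ⟨x, hx⟩ := blockIter_surjective (j := j) (by omega) y
      exact ⟨x, by rw [HiggsAveragingCompose.blockIter_succ, hx, hy]⟩

/-- `(Q_j^*g)(x) = g(x_j)` for the vector field (`B3MultiscaleFields.qStar_apply`). [cite: Balaban1982Higgs1, (2.20) p.610] -/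
theorem vecQAdj_apply (j : ℕ) (g : ScalarField P j P.d) (x : Site P 0) : vecQAdj P j g x = g (blockIter j x) :=
  qStar_apply j g x

/-- `Q_j^*` is injective for `j ≤ K`. [cite: Balaban1982Higgs1, (2.20) p.610] -/
theorem eq_zero_of_vecQAdj_eq_zero {j : ℕ} (hj : j ≤ P.K) {g : ScalarField P j P.d} (h : vecQAdj P j g = 0) :
    g = 0 := by
  funext y
  obtain ⟨x, rfl⟩ := blockIter_surjective hj y
  have hx := congrFun h x
  rwa [vecQAdj_apply] at hx

end Blocks

/-! ## 2. `P(0) = Q^*Q ≥ 0` -/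

section BlockMean

/-- `⟨f, P(0)f⟩ = (L^jη)^d·L^{−d}·Σ_{y∈T^{(j+1)}} |Σ_{x∈B(y)} f(x)|²` (fibrewise summation over the blocks).
[cite: Balaban1982Higgs1, (2.30) p.611] -/
theorem siteInner_blockMean (j : ℕ) (f : ScalarField P j P.d) :
    siteInner f (blockMean P j f)
      = P.mesh j ^ P.d * (((P.L : ℝ) ^ P.d)⁻¹) *
          ∑ y : Site P (j + 1), ‖∑ x ∈ block y, f x‖ ^ 2 := by
  unfold siteInner
  have hfib := Finset.sum_fiberwise_of_maps_to (s := (Finset.univ : Finset (Site P j)))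
    (t := (Finset.univ : Finset (Site P (j + 1)))) (g := blockOf) (fun x _ => Finset.mem_univ _)
    (fun x => P.mesh j ^ P.d * @inner ℝ _ _ (f x) (blockMean P j f x))
  rw [← hfib, Finset.mul_sum]
  refine Finset.sum_congr rfl fun y _ => ?_
  have hblock : Finset.filter (fun x : Site P j => blockOf x = y) Finset.univ = block y := rfl
  rw [hblock]
  have hterm : ∀ x ∈ block y,
      P.mesh j ^ P.d * @inner ℝ _ _ (f x) (blockMean P j f x)
        = P.mesh j ^ P.d * (((P.L : ℝ) ^ P.d)⁻¹) * @inner ℝ _ _ (f x) (∑ x' ∈ block y, f x') := by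
    intro x hx
    have hxy : blockOf x = y := by simpa [block] using hx
    rw [blockMean_apply, hxy, inner_smul_right]
    ring
  rw [Finset.sum_congr rfl hterm, ← Finset.mul_sum, ← sum_inner, real_inner_self_eq_norm_sq]

/-- **`P(0) ≥ 0`**: `0 ≤ ⟨f, P(0)f⟩`. [cite: Balaban1982Higgs1, (2.30) p.611] -/
theorem siteInner_blockMean_nonneg (j : ℕ) (f : ScalarField P j P.d) : 0 ≤ siteInner f (blockMean P j f) := by
  rw [siteInner_blockMean]
  refine mul_nonneg (mul_nonneg (pow_nonneg (P.mesh_pos j).le _) (inv_nonneg.2 (pow_nonneg ?_ _))) ?_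
  · exact_mod_cast P.hL.le
  · exact Finset.sum_nonneg fun y _ => sq_nonneg _

end BlockMean

/-! ## 3. `Δ^{(j)}` is positive definite -/

section Delta

/-- **`Δ^{(0)} = −Δ^η + msq ≥ msq`** (2.17): `msq⟨f,f⟩ ≤ ⟨f, Δ^{(0)}f⟩`. [cite: Balaban1982Higgs1, (2.17) p.610] -/
theorem siteInner_deltaK_zero_ge (msq a : ℝ) (f : ScalarField P 0 P.d) :
    msq * siteInner f f ≤ siteInner f (deltaK P msq a 0 f) := by
  rw [deltaK_zero, LinearMap.add_apply, LinearMap.smul_apply, LinearMap.id_apply, siteInner_add_right,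
    siteInner_smul_right]
  linarith [siteInner_covLaplacianN_nonneg (zeroCharge P.d) Finset.univ (0 : VecField P 0) f]

/-- `a_j(L^jη)^{−2} > 0` for `a > 0`, `L > 1`, `j ≥ 1` (`B1.aSeq_pos`, (2.15)). [cite: Balaban1982Higgs1, (2.15) p.609] -/
theorem coeff221_pos {a : ℝ} (ha : 0 < a) (hL : 1 < (P.L : ℝ)) {j : ℕ} (hj : 1 ≤ j) : 0 < coeff221 P a j :=
  mul_pos (B1.aSeq_pos ha hL hj) (pow_pos (inv_pos.2 (P.mesh_pos j)) 2)

/-- The vector-field `G^η_j` is the propagator `HiggsCovariance.propagatorK` at the trivial coupling; its defining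
operator is `covOpK … = −Δ^η + msq + a_j(L^jη)^{−2}P_j`, with `a_j(L^jη)^{−2} = coeff221`. [cite: Balaban1982Higgs1, (2.20) p.610] -/
theorem covOpK_eq (msq a : ℝ) (j : ℕ) :
    covOpK (zeroCharge P.d) Finset.univ (0 : VecField P 0) msq a j
      = covLaplacianN (zeroCharge P.d) Finset.univ (0 : VecField P 0) + msq • LinearMap.id
        + coeff221 P a j • (vecQAdj P j ∘ₗ vecQ P j) := rfl

/-- Adjointness of the vector-field `Q_j`, `Q_j^*` for the scalar products (1.5) of the two lattices
(`HiggsCovariancePos.siteInner_avgQkLin`). [cite: Balaban1982Higgs1, (2.20) p.610] -/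
theorem siteInner_vecQ_adj (j : ℕ) (g : ScalarField P 0 P.d) (ψ : ScalarField P j P.d) :
    siteInner (vecQ P j g) ψ = siteInner g (vecQAdj P j ψ) :=
  siteInner_avgQkLin _ _ _ _ _

/-- **`Δ^{(j)} > 0` for `j ≥ 1`**: `0 < ⟨ψ, Δ^{(j),L^jη}ψ⟩` for `ψ ≠ 0` (`msq > 0`, `a > 0`, `L > 1`, `1 ≤ j ≤ K`) — the
variational inequality `a_j(L^jη)^{−2}⟨Q_j^*ψ, G^η_jQ_j^*ψ⟩ < ⟨ψ,ψ⟩` behind the well-definedness remark of p. 611, from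
(2.21). PROVED (see the module docstring, §4). [cite: Balaban1982Higgs1, (2.21) p.610] -/
theorem siteInner_deltaK_succ_pos {msq a : ℝ} (hmsq : 0 < msq) (ha : 0 < a) (hL : 1 < (P.L : ℝ)) {j : ℕ}
    (hj : j + 1 ≤ P.K) {ψ : ScalarField P (j + 1) P.d} (hψ : ψ ≠ 0) :
    0 < siteInner ψ (deltaK P msq a (j + 1) ψ) := by
  have hc : 0 < coeff221 P a (j + 1) := coeff221_pos ha hL (Nat.succ_le_succ (Nat.zero_le j))
  have hak : 0 ≤ B1.aSeq a P.L (j + 1) := (B1.aSeq_pos ha hL (Nat.succ_le_succ (Nat.zero_le j))).le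
  have hspos : 0 < sNorm ψ :=
    lt_of_le_of_ne (sNorm_nonneg _) fun h => hψ ((sNorm_eq_zero_iff ψ).mp h.symm)
  set c : ℝ := coeff221 P a (j + 1) with hc_def
  set f : ScalarField P 0 P.d := vecQAdj P (j + 1) ψ with hf_def
  set φ : ScalarField P 0 P.d := vecG P msq a (j + 1) f with hφ_def
  set s : ℝ := sNorm ψ with hs_def
  set u : ℝ := sNorm (vecQ P (j + 1) φ) with hu_def
  have hu0 : 0 ≤ u := sNorm_nonneg _
  -- `(−Δ^η + msq + cP_j)φ = f`
  have hsolve : covOpK (zeroCharge P.d) Finset.univ (0 : VecField P 0) msq a (j + 1) φ = f :=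
    covOpK_propagatorK_apply (zeroCharge P.d) Finset.univ 0 hmsq a (j + 1) hak f
  -- `f ≠ 0`, hence `φ ≠ 0`
  have hf : f ≠ 0 := fun h => hψ (eq_zero_of_vecQAdj_eq_zero hj h)
  have hφ : φ ≠ 0 := by
    intro h
    apply hf
    rw [← hsolve, h, map_zero]
  have hφpos : 0 < siteInner φ φ := by
    rcases (siteInner_self_nonneg φ).lt_or_eq with h | h
    · exact h
    · exact absurd (eq_zero_of_siteInner_self_eq_zero φ h.symm) hφ
  -- `X := ⟨f, φ⟩ = ⟨φ, (−Δ^η)φ⟩ + msq|φ|² + c|Q_jφ|²`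
  have hX : siteInner f φ
      = siteInner φ (covLaplacianN (zeroCharge P.d) Finset.univ (0 : VecField P 0) φ) + msq * siteInner φ φ
        + c * u ^ 2 := by
    have h1 : siteInner f φ
        = siteInner φ (covOpK (zeroCharge P.d) Finset.univ (0 : VecField P 0) msq a (j + 1) φ) := by
      rw [hsolve, siteInner_comm]
    rw [h1, covOpK_eq, ← hc_def, LinearMap.add_apply, LinearMap.add_apply, LinearMap.smul_apply,
      LinearMap.smul_apply, LinearMap.id_apply, LinearMap.comp_apply, siteInner_add_right, siteInner_add_right,
      siteInner_smul_right, siteInner_smul_right, ← siteInner_vecQ_adj, ← sNorm_sq (vecQ P (j + 1) φ), ← hu_def]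
  -- `X = ⟨ψ, Q_jφ⟩ ≤ |ψ||Q_jφ|`
  have hadj : siteInner f φ = siteInner ψ (vecQ P (j + 1) φ) := by
    rw [hf_def, siteInner_comm, ← siteInner_vecQ_adj, siteInner_comm]
  have hXle : siteInner f φ ≤ s * u := by
    rw [hadj]
    exact siteInner_le_sNorm_mul _ _
  -- `X > c|Q_jφ|²`
  have hXgt : c * u ^ 2 < siteInner f φ := by
    rw [hX]
    have := siteInner_covLaplacianN_nonneg (zeroCharge P.d) Finset.univ (0 : VecField P 0) φ
    nlinarith [mul_pos hmsq hφpos]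
  -- hence `u > 0`, `cu < s`, `cX < s²`
  have hupos : 0 < u := by
    rcases hu0.lt_or_eq with h | h
    · exact h
    · exfalso
      rw [← h] at hXgt hXle
      nlinarith
  have hcu : c * u < s := by
    by_contra hnot
    have hle : s ≤ c * u := not_lt.mp hnot
    have : s * u ≤ (c * u) * u := mul_le_mul_of_nonneg_right hle hu0
    nlinarith
  have hcX : c * siteInner f φ < s ^ 2 := by
    have h1 : c * siteInner f φ ≤ c * (s * u) := mul_le_mul_of_nonneg_left hXle hc.le
    have h2 : (c * u) * s < s * s := mul_lt_mul_of_pos_right hcu hspos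
    nlinarith
  -- (2.21): `⟨ψ, Δ^{(j)}ψ⟩ = c|ψ|² − c²X`
  rw [siteInner_deltaK_succ, ← hc_def, LinearMap.comp_apply, LinearMap.comp_apply, ← hf_def, ← hφ_def, ← hadj,
    ← sNorm_sq, ← hs_def]
  nlinarith [mul_pos hc (sub_pos.mpr hcX)]

end Delta

/-! ## 4. The operator of (2.30) is positive definite; `C^{(j),L^jη}` exists -/

section PrecOp

/-- `⟨f,f⟩ > 0` for `f ≠ 0`. [cite: Balaban1982Higgs1, (1.5) p.604] -/
theorem siteInner_self_pos {j M : ℕ} {f : ScalarField P j M} (hf : f ≠ 0) : 0 < siteInner f f := by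
  rcases (siteInner_self_nonneg f).lt_or_eq with h | h
  · exact h
  · exact absurd (eq_zero_of_siteInner_self_eq_zero f h.symm) hf

/-- **The operator of (2.30) is positive definite**: `0 < ⟨f, (a(L^{j+1}η)^{−2}P(0) + Δ^{(j),L^jη})f⟩` for `f ≠ 0`
(`msq > 0`, `a > 0`, `L > 1`, `j ≤ K`) — p. 611 *"It is so"* for the concrete vector-field covariances. PROVED.
[cite: Balaban1982Higgs1, (2.30) p.611] -/
theorem siteInner_precOp_pos {msq a : ℝ} (hmsq : 0 < msq) (ha : 0 < a) (hL : 1 < (P.L : ℝ)) {j : ℕ}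
    (hj : j ≤ P.K) {f : ScalarField P j P.d} (hf : f ≠ 0) : 0 < siteInner f (precOp P msq a j f) := by
  rw [precOp_eq, LinearMap.add_apply, LinearMap.smul_apply, siteInner_add_right, siteInner_smul_right]
  have hP := siteInner_blockMean_nonneg j f
  have hcoef : 0 ≤ a * ((P.mesh (j + 1))⁻¹ ^ 2) := mul_nonneg ha.le (sq_nonneg _)
  have hΔ : 0 < siteInner f (deltaK P msq a j f) := by
    cases j with
    | zero =>
        have h0 := siteInner_deltaK_zero_ge (P := P) msq a f
        nlinarith [mul_pos hmsq (siteInner_self_pos hf)]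
    | succ j => exact siteInner_deltaK_succ_pos hmsq ha hL hj hf
  nlinarith [mul_nonneg hcoef hP]

/-- **`C^{(j),L^jη}` EXISTS** (p. 611: *"the covariances are well defined. It is so"*): the operator of (2.30) is a
unit of the endomorphism ring (injective on a finite-dimensional space), so `HiggsFluctMeasure.fluctCov` is its
two-sided inverse (`HiggsFluctMeasure.precOp_mul_fluctCov`/`fluctCov_mul_precOp`). PROVED. [cite: Balaban1982Higgs1, (2.30) p.611] -/
theorem isUnit_precOp {msq a : ℝ} (hmsq : 0 < msq) (ha : 0 < a) (hL : 1 < (P.L : ℝ)) {j : ℕ} (hj : j ≤ P.K) :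
    IsUnit (precOp P msq a j : Module.End ℝ (ScalarField P j P.d)) := by
  rw [LinearMap.isUnit_iff_ker_eq_bot, LinearMap.ker_eq_bot']
  intro f hf0
  by_contra hne
  have h := siteInner_precOp_pos hmsq ha hL hj hne
  rw [hf0] at h
  simp [siteInner] at h

/-- `(a(L^{j+1}η)^{−2}P(0) + Δ^{(j)}) · C^{(j),L^jη} = 1`, hypotheses discharged. [cite: Balaban1982Higgs1, (2.30) p.611] -/
theorem precOp_mul_fluctCov {msq a : ℝ} (hmsq : 0 < msq) (ha : 0 < a) (hL : 1 < (P.L : ℝ)) {j : ℕ} (hj : j ≤ P.K) :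
    (precOp P msq a j : Module.End ℝ (ScalarField P j P.d)) * fluctCov P msq a j = 1 :=
  HiggsFluctMeasure.precOp_mul_fluctCov msq a j (isUnit_precOp hmsq ha hL hj)

/-- `C^{(j),L^jη} · (a(L^{j+1}η)^{−2}P(0) + Δ^{(j)}) = 1`, hypotheses discharged. [cite: Balaban1982Higgs1, (2.30) p.611] -/
theorem fluctCov_mul_precOp {msq a : ℝ} (hmsq : 0 < msq) (ha : 0 < a) (hL : 1 < (P.L : ℝ)) {j : ℕ} (hj : j ≤ P.K) :
    fluctCov P msq a j * (precOp P msq a j : Module.End ℝ (ScalarField P j P.d)) = 1 :=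
  HiggsFluctMeasure.fluctCov_mul_precOp msq a j (isUnit_precOp hmsq ha hL hj)

end PrecOp

/-! ## 5. A coercive bound for the Gaussian exponent and the integrability of the weight -/

section Integrable

/-- `toSite` is homogeneous. [cite: Balaban1982Higgs1, p.608] -/
theorem toSite_smul {j : ℕ} (t : ℝ) (A : VecField P j) : toSite (t • A) = t • toSite A := by
  funext x
  ext μ
  simp [toSite]

/-- `toSite A = 0` only for `A = 0` (it is a re-indexing). [cite: Balaban1982Higgs1, p.608] -/
theorem eq_zero_of_toSite_eq_zero {j : ℕ} {A : VecField P j} (h : toSite A = 0) : A = 0 := by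
  rw [← ofSite_toSite A, h]
  funext b
  rfl

/-- The Gaussian exponent `q(A′) = ⟨A′, (C^{(j)})^{−1}A′⟩` is 2-homogeneous. [cite: Balaban1982Higgs1, (3.35) p.618] -/
theorem quadForm_smul (msq a : ℝ) (j : ℕ) (t : ℝ) (A : VecField P j) :
    siteInner (toSite (t • A)) (precOp P msq a j (toSite (t • A)))
      = t ^ 2 * siteInner (toSite A) (precOp P msq a j (toSite A)) := by
  rw [toSite_smul, map_smul, siteInner_smul_left, siteInner_smul_right]
  ring

/-- The Gaussian exponent is continuous in the field. [cite: Balaban1982Higgs1, (3.35) p.618] -/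
theorem continuous_quadForm (msq a : ℝ) (j : ℕ) :
    Continuous fun A : VecField P j => siteInner (toSite A) (precOp P msq a j (toSite A)) := by
  have hlin : Continuous (fun f : ScalarField P j P.d => precOp P msq a j f) :=
    LinearMap.continuous_of_finiteDimensional _
  exact HiggsFluctMeasure.continuous_siteInner HiggsFluctMeasure.continuous_toSite
    (hlin.comp HiggsFluctMeasure.continuous_toSite)

/-- The bond set of a lattice of the family is nonempty (`d ≥ 1`, every torus has a site). [cite: Balaban1982Higgs1, (1.4) p.604] -/
theorem nonempty_pBond (j : ℕ) : Nonempty (PBond P j) := ⟨⟨default, ⟨0, P.hd⟩⟩⟩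

/-- **Coercivity of the Gaussian exponent**: there is `c > 0` with `c·Σ_b A_b² ≤ ⟨A, (C^{(j),L^jη})^{−1}A⟩` for all bond
functions `A` (positive definite form on a finite-dimensional space: minimum on the unit sphere of the sup norm and
2-homogeneity; `msq > 0`, `a > 0`, `L > 1`, `j ≤ K`). PROVED. [cite: Balaban1982Higgs1, (2.30) p.611] -/
theorem exists_quadForm_ge {msq a : ℝ} (hmsq : 0 < msq) (ha : 0 < a) (hL : 1 < (P.L : ℝ)) {j : ℕ} (hj : j ≤ P.K) :
    ∃ c : ℝ, 0 < c ∧ ∀ A : VecField P j,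
      c * ∑ b : PBond P j, A b ^ 2 ≤ siteInner (toSite A) (precOp P msq a j (toSite A)) := by
  set q : VecField P j → ℝ := fun A => siteInner (toSite A) (precOp P msq a j (toSite A)) with hq_def
  have hq : Continuous q := continuous_quadForm msq a j
  have hS : IsCompact (Metric.sphere (0 : VecField P j) 1) := isCompact_sphere _ _
  haveI : Nonempty (PBond P j) := nonempty_pBond j
  have hA₀ : (fun _ : PBond P j => (1 : ℝ)) ∈ Metric.sphere (0 : VecField P j) 1 := by
    rw [mem_sphere_zero_iff_norm, pi_norm_const, norm_one]
  obtain ⟨A₁, hA₁S, hmin⟩ := hS.exists_isMinOn ⟨_, hA₀⟩ hq.continuousOn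
  have hA₁ : A₁ ≠ 0 := by
    intro h
    rw [h, mem_sphere_zero_iff_norm, norm_zero] at hA₁S
    exact zero_ne_one hA₁S
  have hc₀ : 0 < q A₁ :=
    siteInner_precOp_pos hmsq ha hL hj fun h => hA₁ (eq_zero_of_toSite_eq_zero h)
  have hcard : 0 < (Fintype.card (PBond P j) : ℝ) := by exact_mod_cast Fintype.card_pos
  refine ⟨q A₁ / Fintype.card (PBond P j), div_pos hc₀ hcard, fun A => ?_⟩
  -- `Σ_b A_b² ≤ card · ‖A‖²`
  have hsum : ∑ b : PBond P j, A b ^ 2 ≤ Fintype.card (PBond P j) * ‖A‖ ^ 2 := by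
    have hb : ∀ b : PBond P j, A b ^ 2 ≤ ‖A‖ ^ 2 := fun b => by
      rw [← sq_abs, ← Real.norm_eq_abs]
      exact pow_le_pow_left₀ (norm_nonneg _) (norm_le_pi_norm A b) 2
    calc ∑ b : PBond P j, A b ^ 2 ≤ ∑ _b : PBond P j, ‖A‖ ^ 2 := Finset.sum_le_sum fun b _ => hb b
      _ = Fintype.card (PBond P j) * ‖A‖ ^ 2 := by rw [Finset.sum_const, nsmul_eq_mul, Finset.card_univ]
  -- `q A ≥ q A₁ · ‖A‖²`
  have hqA : q A₁ * ‖A‖ ^ 2 ≤ q A := by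
    by_cases hA : A = 0
    · have hq0 : q 0 = 0 := by
        have h := quadForm_smul msq a j 0 A₁
        rw [zero_smul] at h
        simpa [hq_def] using h
      rw [hA, norm_zero, hq0]
      simp
    · have hnorm : 0 < ‖A‖ := norm_pos_iff.mpr hA
      have hB : ‖A‖⁻¹ • A ∈ Metric.sphere (0 : VecField P j) 1 := by
        rw [mem_sphere_zero_iff_norm, norm_smul, norm_inv, norm_norm, inv_mul_cancel₀ hnorm.ne']
      have hminB : q A₁ ≤ q (‖A‖⁻¹ • A) := hmin hB
      have hscale : q A = ‖A‖ ^ 2 * q (‖A‖⁻¹ • A) := by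
        have := quadForm_smul msq a j ‖A‖ (‖A‖⁻¹ • A)
        rw [smul_smul, mul_inv_cancel₀ hnorm.ne', one_smul] at this
        exact this
      rw [hscale]
      nlinarith [sq_nonneg ‖A‖, mul_le_mul_of_nonneg_left hminB (sq_nonneg ‖A‖)]
  calc q A₁ / Fintype.card (PBond P j) * ∑ b : PBond P j, A b ^ 2
      ≤ q A₁ / Fintype.card (PBond P j) * (Fintype.card (PBond P j) * ‖A‖ ^ 2) :=
        mul_le_mul_of_nonneg_left hsum (div_pos hc₀ hcard).le
    _ = q A₁ * ‖A‖ ^ 2 := by field_simp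
    _ ≤ q A := hqA

/-- **The Gaussian weight `exp(−½⟨A′,(C^{(j)})^{−1}A′⟩)` is integrable** against Lebesgue measure `dA′_j` (dominated by
a product of one-dimensional Gaussians `Π_b e^{−(c/2)A′_b²}`; `msq > 0`, `a > 0`, `L > 1`, `j ≤ K`). PROVED.
[cite: Balaban1982Higgs1, (3.35) p.618] -/
theorem integrable_gaussWeight {msq a : ℝ} (hmsq : 0 < msq) (ha : 0 < a) (hL : 1 < (P.L : ℝ)) {j : ℕ}
    (hj : j ≤ P.K) : Integrable (gaussWeight P msq a j) := by
  obtain ⟨c, hc, hbound⟩ := exists_quadForm_ge hmsq ha hL hj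
  have hg : Integrable (fun A : VecField P j => ∏ b : PBond P j, Real.exp (-(c / 2) * A b ^ 2)) := by
    have h := Integrable.fintype_prod (ι := PBond P j) (f := fun (_ : PBond P j) (x : ℝ) => Real.exp (-(c / 2) * x ^ 2))
      (μ := fun _ => (volume : Measure ℝ)) (fun _ => integrable_exp_neg_mul_sq (by positivity : 0 < c / 2))
    simpa [volume_pi] using h
  refine hg.mono' (measurable_gaussWeight msq a j).aestronglyMeasurable (Filter.Eventually.of_forall fun A => ?_)
  rw [Real.norm_of_nonneg (gaussWeight_nonneg msq a j A), gaussWeight_eq, ← Real.exp_sum, Real.exp_le_exp,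
    ← Finset.mul_sum]
  have := hbound A
  nlinarith

/-- `0 < ∫dA′_j exp(−½⟨A′_j,(C^{(j)})^{−1}A′_j⟩)` (hypotheses of `HiggsFluctMeasure.gaussNorm_pos` discharged).
[cite: Balaban1982Higgs1, (3.35) p.618] -/
theorem gaussNorm_pos {msq a : ℝ} (hmsq : 0 < msq) (ha : 0 < a) (hL : 1 < (P.L : ℝ)) {j : ℕ} (hj : j ≤ P.K) :
    0 < gaussNorm P msq a j :=
  HiggsFluctMeasure.gaussNorm_pos msq a j (integrable_gaussWeight hmsq ha hL hj)

/-- **`dμ_{C^{(j),L^jη}}` is a probability measure** in the paper's regime (`msq > 0`, `a > 0`, `L > 1`, `j ≤ K`) —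
III (1.4) p. 412 / I p. 617 *"independent Gaussian random variables with the covariances C^{(j),L^jε}"*, hypotheses of
`HiggsFluctMeasure.isProbabilityMeasure_fluctMeasure` discharged. PROVED. [cite: Balaban1983Higgs3, (1.4) p.412] -/
theorem fluctMeasure_isProbability {msq a : ℝ} (hmsq : 0 < msq) (ha : 0 < a) (hL : 1 < (P.L : ℝ)) {j : ℕ}
    (hj : j ≤ P.K) : IsProbabilityMeasure (fluctMeasure P msq a j) :=
  isProbabilityMeasure_fluctMeasure msq a j (integrable_gaussWeight hmsq ha hL hj)

/-- **`Π_{j<k} dμ_{C^{(j),L^jη}}` is a probability measure** for `k ≤ K` (the product measure of the independent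
fluctuation fields, p. 617). PROVED. [cite: Balaban1983Higgs3, (1.4) p.412] -/
theorem fluctFamily_isProbability {msq a : ℝ} (hmsq : 0 < msq) (ha : 0 < a) (hL : 1 < (P.L : ℝ)) {k : ℕ}
    (hk : k ≤ P.K) : IsProbabilityMeasure (fluctFamily P msq a k) :=
  isProbabilityMeasure_fluctFamily msq a k fun j => integrable_gaussWeight hmsq ha hL ((Nat.le_of_lt j.isLt).trans hk)

end Integrable

end Literature.MathematicalPhysics.QuantumFieldTheory.Balaban1983to89.HiggsFluctMeasurePos
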